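import Mathlib
import HarnessLib
import Summits.NavierStokesRegularity.NavierStokesRegularity.Theses.AxisTwistDoor
import Summits.NavierStokesRegularity.NavierStokesRegularity.Theorems.FilamentPinchDoorFilamentaryGrowth
import Summits.NavierStokesRegularity.NavierStokesRegularity.Theorems.AxisTwistDoorRotationToAxis
import Summits.NavierStokesRegularity.NavierStokesRegularity.Theorems.AxisTwistDoorScalingToUnit
import Summits.NavierStokesRegularity.NavierStokesRegularity.Theorems.AxisTwistDoorAveragedConeLiouville

/-!
# `AxisTwistDoor.Assembly` (item stmt-NavierStokesRegularity-26998) and the half-space window door along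
  this route, modulo its open cruxes

* `axisTwistDoor_assembly_proof : Assembly` — pure logic: `Assembly` (rev 2) is
  `SuitableHalfSpaceZoom → FilamentaryGrowth → TiltDominationLoc → AveragedConeLiouville → ScalingToUnit →
  RotationToAxis → HalfSpaceWindowDoor.Target`, i.e. the type of the route's planner-authored deciding
  theorem `Theses.AxisTwistDoor.closes` (kernel-checked in the route file); this item is that composition
  BY NAME (candidate attached to the item by refuter1 g10, 2026-08-28T08:50Z, landed here).
* `axisTwistDoor_target_of_cruxes : TiltDominationLoc → AveragedConeLiouville → HalfSpaceWindowDoor.Target`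
  — the door with its four PROVED items plugged in by name (`SuitableHalfSpaceZoom_holds`, item 26432;
  `axisTwistDoor_filamentaryGrowth_proof`, item 26431; `AxisTwistDoorScalingToUnit.scalingToUnit_proof`,
  item 26992; `AxisTwistDoorRotationToAxis.rotationToAxis_proof`, item 26890): along THIS route the door
  leaf `HalfSpaceWindowDoor.Target` (rung N0-LocalTubeDoorHalfSpace) depends on EXACTLY its two open
  cruxes, `TiltDominationLoc` (stmt-26991) and `AveragedConeLiouville` (stmt-26889).
* `axisTwistDoor_target_of_tiltDominationLoc_of_facts` — the same with `AveragedConeLiouville` replaced by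
  the two NAMED FACTS it was CONDITIONALLY closed on (`AxisTwistDoorAveragedConeLiouville.
  averagedConeLiouville_of_facts`, p628780): Lei–Ren 2024 quantitative regular shells
  (`Literature.Analysis.FluidPDE.LeiRen2024_quantitative_regular_shells_cyl`) and Nazarov–Ural'tseva 2011
  positivity propagation (`Literature.Analysis.FluidPDE.NazarovUraltseva2011_positivity_propagation` at
  `E := ℝ³`), both UNDISCHARGED named facts of the tree at the time of writing — a CONDITIONAL result.

HONEST FRAMING: bookkeeping; the door's `Target` is NOT proved (it is reduced to the open crux
`TiltDominationLoc` plus either the open crux `AveragedConeLiouville` or two undischarged named facts);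
nothing here bears on Navier–Stokes regularity; no summit statement is proved here.
-/

noncomputable section

set_option linter.dupNamespace false

namespace Summit.NavierStokesRegularity.NavierStokesRegularity.Theorems

open Summit.NavierStokesRegularity.NavierStokesRegularity.Theses.AxisTwistDoor

/-- **Item stmt-NavierStokesRegularity-26998** (`AxisTwistDoor.Assembly`, rev 2): the six items compose
to the door's `Target` — by the route's own kernel-checked deciding theorem `closes`. [folklore] -/
theorem axisTwistDoor_assembly_proof :
    Summit.NavierStokesRegularity.NavierStokesRegularity.Theses.AxisTwistDoor.Assembly := by
  unfold Summit.NavierStokesRegularity.NavierStokesRegularity.Theses.AxisTwistDoor.Assembly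
  exact fun hZ hF hT hA hS hR => closes hZ hF hT hA hS hR

/-- **The half-space window door along `AxisTwistDoor`, modulo its two cruxes**: with items 26432
(`SuitableHalfSpaceZoom`), 26431 (`FilamentaryGrowth`), 26992 (`ScalingToUnit`) and 26890
(`RotationToAxis`) proved in the tree, the OPEN cruxes `TiltDominationLoc` (stmt-26991) and
`AveragedConeLiouville` (stmt-26889) alone imply the door's `Target`. [folklore] -/
theorem axisTwistDoor_target_of_cruxes
    (hT : Summit.NavierStokesRegularity.NavierStokesRegularity.Theses.AxisTwistDoor.TiltDominationLoc)
    (hA : Summit.NavierStokesRegularity.NavierStokesRegularity.Theses.AxisTwistDoor.AveragedConeLiouville) :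
    Summit.NavierStokesRegularity.NavierStokesRegularity.Theses.HalfSpaceWindowDoor.Target :=
  closes SuitableHalfSpaceZoom_holds axisTwistDoor_filamentaryGrowth_proof hT hA
    AxisTwistDoorScalingToUnit.scalingToUnit_proof AxisTwistDoorRotationToAxis.rotationToAxis_proof

/-- **The half-space window door along `AxisTwistDoor`, modulo `TiltDominationLoc` and two NAMED FACTS**:
the crux `AveragedConeLiouville` is supplied by its conditional closing theorem
`averagedConeLiouville_of_facts` (p628780), so the door's `Target` follows from the OPEN crux
`TiltDominationLoc` (stmt-26991) together with the undischarged named facts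
`LeiRen2024_quantitative_regular_shells_cyl` and `NazarovUraltseva2011_positivity_propagation (E := ℝ³)`.
CONDITIONAL on those two facts. [folklore] -/
theorem axisTwistDoor_target_of_tiltDominationLoc_of_facts
    (hT : Summit.NavierStokesRegularity.NavierStokesRegularity.Theses.AxisTwistDoor.TiltDominationLoc)
    (h₁ : Literature.Analysis.FluidPDE.LeiRen2024_quantitative_regular_shells_cyl)
    (h₂ : Literature.Analysis.FluidPDE.NazarovUraltseva2011_positivity_propagation
      (E := EuclideanSpace ℝ (Fin 3))) :
    Summit.NavierStokesRegularity.NavierStokesRegularity.Theses.HalfSpaceWindowDoor.Target :=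
  axisTwistDoor_target_of_cruxes hT
    (AxisTwistDoorAveragedConeLiouville.averagedConeLiouville_of_facts h₁ h₂)

end Summit.NavierStokesRegularity.NavierStokesRegularity.Theorems

end
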